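import Summits.BirchSwinnertonDyer.BirchSwinnertonDyer.Theorems.ManinLocalTwoThreeKatoShiftPrimeClassLattice
import Literature.NumberTheory.EllipticCurves.ModularSymbolsManin
import HarnessLib

/-!
# Route `ManinLocalTwoThree`, crux C2 `ManinOddAtFour` (stmt-BirchSwinnertonDyer-22967), line `kato-shift-two`
# (es g7): PRIME-CLASS GENERATION — the period lattice `Λ_f` is generated by the prime classes `{0, a/ℓ}_f`
# over the primes `ℓ` of any cofinal set of arithmetic progressions allowed by the level; at `4 ∣ N` by the
# ADMISSIBLE primes `ℓ ≡ 3 (mod 4)`, `ℓ ≥ ℓ₀` of the multi-shift generation law E-es-22 (line prover p3; helper,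
# unconditional)

The generation law E-es-22 `MultiShiftClassGenerationTwo` (leaf `KatoShiftTwoLaws`, the registered stub
`stub_multiShiftClass_generation` of the line) asks that the MULTI-SHIFT classes
`Σ_{T ⊆ Gen(N)} (−1)^{|T|} {0, a∏T/ℓ}_f` over admissible primes `ℓ ≥ ℓ₀` span an odd-index subgroup of
`Λ_f`. Its classical half — that the plain prime classes `{0, a/ℓ}_f = {∞, a/ℓ}_f − {∞, 0}_f` over the
SAME primes already generate ALL of `Λ_f` — is proved here, unconditionally, for every cusp form
`f ∈ S₂(Γ₀(N))` (route-independent: only Literature modules and the sibling helper `…KatoShiftPrimeClassLattice`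
are imported; the prime class is written out as `modularSymbol f (a/ℓ) − modularSymbol f 0`, which is the
cell's `ManinAdditive.primeClass f ℓ a` by `rfl`):

* `cuspSymbol_eq_modularSymbol_div_sub` — `{∞, γ∞}_f = {∞, b/d}_f − {∞, 0}_f` for `γ = (a b; c d) ∈ Γ₀(N)`,
  `d ≠ 0` (`γS∞ = γ0 = b/d` and the Manin relation `inftySymbol_gamma0_mul`);
* `exists_gamma0_lowerMul` — left multiplication by the parabolic `(1 0; Nk 1)` keeps `b` and the period and
  moves `d` to `d + Nkb`; `exists_gamma0_neg` — `−γ` has the same period;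
* `cuspSymbol_mem_closure_primeClass` — **Dirichlet step**: every period `{∞, γ∞}_f` is a prime class
  `{0, a/ℓ}_f` with `ℓ` a prime `> n₀` in the progression `ℓ ≡ d (mod N)` (Mathlib's
  `Nat.forall_exists_prime_gt_and_zmodEq` on the progression `d + N·b·ℤ`, `gcd(d, Nb) = 1` from `ad − bc = 1`);
* `periodLattice_eq_closure_primeClass` — `Λ_f` is the closure of the prime classes over primes `ℓ > n₀`,
  `ℓ ∤ N` (any `n₀`);
* `periodLattice_le_closure_primeClass_three_mod_four` — for `4 ∣ N` the primes may be taken `≡ 3 (mod 4)`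
  (`d` is odd and `−γ` flips `d mod 4`);
* `periodLattice_le_closure_primeClass_admissibleTwo` — hence over the ADMISSIBLE primes `ℓ ≥ ℓ₀` of E-es-22
  verbatim (`ℓ ∤ N`, `ℓ ≡ 3 (mod 4)`, no `t ∈ {8} ∪ {q ∥ N}` is `±1 mod ℓ` — automatic for `ℓ > N + 9`);
* (sibling file `…PrimeClassGenerationEdges`) E-es-22 is therefore EQUIVALENT to its prime-classwise form: an
  odd `m` with `m·{0, a/ℓ}_f` in the multi-shift span for every admissible `ℓ ≥ ℓ₀` and `0 < a < ℓ` (the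
  conjecture lives entirely in the passage from prime classes to their multi-shift combinations).

Nothing about BSD is proved here; Manin's conjecture at `2` is NOT proved here; E-es-22 is NOT proved here.
-/

set_option autoImplicit false
set_option linter.dupNamespace false

noncomputable section

open scoped Classical MatrixGroups ModularForm

open CongruenceSubgroup Matrix.SpecialLinearGroup ModularGroup
  Literature.NumberTheory.EllipticCurves Literature.NumberTheory.EllipticCurves.ModularForms

namespace Summit.BirchSwinnertonDyer.BirchSwinnertonDyer.Theorems.ManinLocalTwoThree

section CuspSymbolAsPrimeClass

variable {N : ℕ} [NeZero N] (f : CuspForm (Gamma0 N) 2)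

/-- **`{∞, γ∞}_f = {∞, b/d}_f − {∞, 0}_f`** for `γ = (a b; c d) ∈ Γ₀(N)` with `d ≠ 0`: `γS∞ = γ0 = b/d`,
so the Manin relation `{∞, γS∞} = {∞, γ∞} + {∞, S∞}` reads `{∞, b/d} = {∞, γ∞} + {∞, 0}`.
[cite: Manin1972, Prop. 1.4 / Thm. 1.6] -/
theorem cuspSymbol_eq_modularSymbol_div_sub (γ : Gamma0 N) (hd : ((γ : SL(2, ℤ)) 1 1 : ℤ) ≠ 0) :
    cuspSymbol f γ =
      modularSymbol f ((((γ : SL(2, ℤ)) 0 1 : ℤ) : ℚ) / (((γ : SL(2, ℤ)) 1 1 : ℤ) : ℚ)) -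
        modularSymbol f 0 := by
  have h := inftySymbol_gamma0_mul f γ S
  have h10 : (((γ : SL(2, ℤ)) * S) 1 0 : ℤ) = (γ : SL(2, ℤ)) 1 1 := by
    simp [coe_S, Matrix.mul_apply, Fin.sum_univ_two]
  have h00 : (((γ : SL(2, ℤ)) * S) 0 0 : ℤ) = (γ : SL(2, ℤ)) 0 1 := by
    simp [coe_S, Matrix.mul_apply, Fin.sum_univ_two]
  have hL : inftySymbol f ((γ : SL(2, ℤ)) * S) =
      modularSymbol f ((((γ : SL(2, ℤ)) 0 1 : ℤ) : ℚ) / (((γ : SL(2, ℤ)) 1 1 : ℤ) : ℚ)) := by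
    rw [inftySymbol, h10, h00, if_neg hd]
  rw [hL, inftySymbol_S] at h
  linear_combination -h

/-- **Parabolic modification**: for `γ = (a b; c d) ∈ Γ₀(N)` and `k ∈ ℤ` there is `γ' ∈ Γ₀(N)` (namely
`(1 0; Nk 1)·γ`) with the same `b`, with `d' = d + Nkb`, and with the same period `{∞, γ'∞}_f = {∞, γ∞}_f`
(the parabolic factor fixes the cusp `0`, so its period `{∞, 0/1} − {∞, 0}` vanishes). [folklore] -/
theorem exists_gamma0_lowerMul (γ : Gamma0 N) (k : ℤ) :
    ∃ γ' : Gamma0 N, ((γ' : SL(2, ℤ)) 0 1 : ℤ) = (γ : SL(2, ℤ)) 0 1 ∧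
      ((γ' : SL(2, ℤ)) 1 1 : ℤ) = (γ : SL(2, ℤ)) 1 1 + N * k * (γ : SL(2, ℤ)) 0 1 ∧
      cuspSymbol f γ' = cuspSymbol f γ := by
  obtain ⟨δ, h00, h01, h10, h11⟩ : ∃ δ : Gamma0 N, ((δ : SL(2, ℤ)) 0 0 : ℤ) = 1 ∧
      ((δ : SL(2, ℤ)) 0 1 : ℤ) = 0 ∧ ((δ : SL(2, ℤ)) 1 0 : ℤ) = N * k ∧ ((δ : SL(2, ℤ)) 1 1 : ℤ) = 1 := by
    let M : Matrix (Fin 2) (Fin 2) ℤ := !![1, 0; (N : ℤ) * k, 1]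
    have hdet : M.det = 1 := by
      rw [Matrix.det_fin_two_of]
      ring
    let δ₀ : SL(2, ℤ) := ⟨M, hdet⟩
    have hmem : δ₀ ∈ Gamma0 N := by
      rw [Gamma0_mem]
      show ((((N : ℤ) * k : ℤ)) : ZMod N) = 0
      push_cast
      simp
    exact ⟨⟨δ₀, hmem⟩, rfl, rfl, rfl, rfl⟩
  refine ⟨δ * γ, ?_, ?_, ?_⟩
  · have : (((δ : SL(2, ℤ)) * (γ : SL(2, ℤ))) 0 1 : ℤ) =
        (δ : SL(2, ℤ)) 0 0 * (γ : SL(2, ℤ)) 0 1 + (δ : SL(2, ℤ)) 0 1 * (γ : SL(2, ℤ)) 1 1 := by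
      simp [Matrix.mul_apply, Fin.sum_univ_two]
    rw [Subgroup.coe_mul, this, h00, h01]
    ring
  · have : (((δ : SL(2, ℤ)) * (γ : SL(2, ℤ))) 1 1 : ℤ) =
        (δ : SL(2, ℤ)) 1 0 * (γ : SL(2, ℤ)) 0 1 + (δ : SL(2, ℤ)) 1 1 * (γ : SL(2, ℤ)) 1 1 := by
      simp [Matrix.mul_apply, Fin.sum_univ_two]
    rw [Subgroup.coe_mul, this, h10, h11]
    ring
  · rw [cuspSymbol_mul_holds f δ γ]
    have hδ : cuspSymbol f δ = 0 := by
      rw [cuspSymbol_eq_modularSymbol_div_sub f δ (by rw [h11]; exact one_ne_zero), h01, h11]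
      simp
    rw [hδ, zero_add]

omit [NeZero N] in
/-- **`−γ` has the same period**: `{∞, (−γ)∞}_f = {∞, γ∞}_f` (`(−a)/(−c) = a/c`), and `−γ ∈ Γ₀(N)` has
second column `(−b, −d)`. [folklore] -/
theorem exists_gamma0_neg (γ : Gamma0 N) :
    ∃ γ' : Gamma0 N, ((γ' : SL(2, ℤ)) 0 1 : ℤ) = -(γ : SL(2, ℤ)) 0 1 ∧
      ((γ' : SL(2, ℤ)) 1 1 : ℤ) = -(γ : SL(2, ℤ)) 1 1 ∧ cuspSymbol f γ' = cuspSymbol f γ := by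
  have hmem : -(γ : SL(2, ℤ)) ∈ Gamma0 N := by
    have h := Gamma0_mem.mp γ.2
    rw [Gamma0_mem]
    simp only [Matrix.SpecialLinearGroup.coe_neg, Matrix.neg_apply, Int.cast_neg, h, neg_zero]
  refine ⟨⟨-(γ : SL(2, ℤ)), hmem⟩, by simp, by simp, ?_⟩
  rw [cuspSymbol_eq_inftySymbol, cuspSymbol_eq_inftySymbol]
  exact inftySymbol_neg f (γ : SL(2, ℤ))

/-- **The prime class is a period** (natural-number form of `primeClass_mem_periodLattice`): for a prime
`ℓ ∤ N` and `0 < a < ℓ`, `{0, a/ℓ}_f ∈ Λ_f`. [cite: Manin1972, Prop. 1.4 / Thm. 1.6] -/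
theorem primeClass_mem_periodLattice_of_lt {ℓ a : ℕ} (hℓ : ℓ.Prime) (hℓN : ¬ ℓ ∣ N) (ha0 : 0 < a)
    (ha : a < ℓ) : modularSymbol f ((a : ℚ) / ℓ) - modularSymbol f 0 ∈ periodLattice f := by
  have hℓa : ¬ ℓ ∣ a := fun h => absurd (Nat.le_of_dvd ha0 h) (not_le.mpr ha)
  have hcop : IsCoprime (ℓ : ℤ) ((a : ℤ) * N) := by
    refine IsCoprime.mul_right ?_ ?_
    · rw [Int.isCoprime_iff_gcd_eq_one, Int.gcd_natCast_natCast]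
      exact (Nat.Prime.coprime_iff_not_dvd hℓ).mpr hℓa
    · rw [Int.isCoprime_iff_gcd_eq_one, Int.gcd_natCast_natCast]
      exact (Nat.Prime.coprime_iff_not_dvd hℓ).mpr hℓN
  have h := primeClass_mem_periodLattice f (by exact_mod_cast hℓ.ne_zero) hcop
  simpa only [Int.cast_natCast] using h

/-- **Dirichlet step — every period is a prime class in the progression `ℓ ≡ d (mod N)`**: for
`γ = (a b; c d) ∈ Γ₀(N)` and any `n₀`, the period `{∞, γ∞}_f` lies in the subgroup generated by
the prime classes `{0, a'/ℓ}_f` with `ℓ` prime, `ℓ > n₀`, `ℓ ≡ d (mod N)`, `0 < a' < ℓ` — indeed it IS such a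
class (or `0` when `b = 0`): `gcd(d, Nb) = 1` from `ad − bc = 1`, `N ∣ c`, so Dirichlet's theorem
(`Nat.forall_exists_prime_gt_and_zmodEq`) gives a prime `ℓ = d + Nkb > n₀`; the parabolic modification
`exists_gamma0_lowerMul` realises `(b, ℓ)` as a second column with the same period, which is then
`{∞, b/ℓ} − {∞, 0} = {0, (b mod ℓ)/ℓ}` (`cuspSymbol_eq_modularSymbol_div_sub`, `{∞, r + 1} = {∞, r}`).
[cite: Manin1972, Prop. 1.4 / Thm. 1.6] -/
theorem cuspSymbol_mem_closure_primeClass (γ : Gamma0 N) (n₀ : ℕ) :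
    cuspSymbol f γ ∈ AddSubgroup.closure
      {z : ℂ | ∃ ℓ : ℕ, ℓ.Prime ∧ n₀ < ℓ ∧ (ℓ : ℤ) ≡ (γ : SL(2, ℤ)) 1 1 [ZMOD N] ∧
        ∃ a : ℕ, 0 < a ∧ a < ℓ ∧ z = modularSymbol f ((a : ℚ) / ℓ) - modularSymbol f 0} := by
  set b : ℤ := (γ : SL(2, ℤ)) 0 1 with hb
  set d : ℤ := (γ : SL(2, ℤ)) 1 1 with hd
  have hdet := Matrix.SpecialLinearGroup.det_coe (γ : SL(2, ℤ))
  rw [Matrix.det_fin_two, ← hb, ← hd] at hdet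
  obtain ⟨c', hc'⟩ : (N : ℤ) ∣ (γ : SL(2, ℤ)) 1 0 :=
    (ZMod.intCast_zmod_eq_zero_iff_dvd _ N).mp (Gamma0_mem.mp γ.2)
  rw [hc'] at hdet
  -- hdet : γ₀₀ * d - b * (N * c') = 1
  by_cases hb0 : b = 0
  · -- `γ0 = 0`: the period `{∞, 0/d} − {∞, 0}` vanishes
    have hd0 : d ≠ 0 := by
      intro h0
      rw [hb0, h0] at hdet
      simp at hdet
    have h0 : cuspSymbol f γ = 0 := by
      rw [cuspSymbol_eq_modularSymbol_div_sub f γ hd0, ← hb, hb0]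
      simp
    rw [h0]
    exact zero_mem _
  · -- Dirichlet on the progression `d + N·b·ℤ`
    have hcopNb : IsCoprime d ((N : ℤ) * b) :=
      ⟨(γ : SL(2, ℤ)) 0 0, -c', by linear_combination hdet⟩
    have hcopb : IsCoprime d b :=
      ⟨(γ : SL(2, ℤ)) 0 0, -((N : ℤ) * c'), by linear_combination hdet⟩
    set q : ℕ := N * b.natAbs with hq
    have hq0 : q ≠ 0 := mul_ne_zero (NeZero.ne N) (Int.natAbs_ne_zero.mpr hb0)
    have hqabs : (q : ℤ) = N * |b| := by
      rw [hq]
      push_cast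
      ring
    have hqZ : (q : ℤ) = N * b ∨ (q : ℤ) = -(N * b) := by
      rcases abs_choice b with h | h
      · left
        rw [hqabs, h]
      · right
        rw [hqabs, h]
        ring
    have hcopq : IsCoprime d (q : ℤ) := by
      rcases hqZ with h | h
      · rw [h]; exact hcopNb
      · rw [h]; exact hcopNb.neg_right
    obtain ⟨ℓ, hℓn, hℓp, hℓd⟩ := Nat.forall_exists_prime_gt_and_zmodEq (max n₀ 1) hq0 hcopq
    -- `ℓ = d + N k b`
    obtain ⟨k, hk⟩ : ∃ k : ℤ, (ℓ : ℤ) = d + N * k * b := by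
      obtain ⟨t, ht⟩ := (Int.modEq_iff_dvd.mp hℓd)
      -- ht : d - ℓ = q * t
      rcases hqZ with h | h
      · exact ⟨-t, by rw [h] at ht; linear_combination -ht⟩
      · exact ⟨t, by rw [h] at ht; linear_combination -ht⟩
    obtain ⟨γ', h01', h11', hγ'⟩ := exists_gamma0_lowerMul f γ k
    rw [← hb] at h01'
    rw [← hb, ← hd, ← hk] at h11'
    have hℓ0 : (ℓ : ℤ) ≠ 0 := by exact_mod_cast hℓp.ne_zero
    haveI : NeZero ℓ := ⟨hℓp.ne_zero⟩
    -- the period is the prime class `{0, (b mod ℓ)/ℓ}`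
    have hper : cuspSymbol f γ =
        modularSymbol f ((((b : ZMod ℓ).val : ℕ) : ℚ) / ℓ) - modularSymbol f 0 := by
      rw [← hγ', cuspSymbol_eq_modularSymbol_div_sub f γ' (by rw [h11']; exact hℓ0), h01', h11',
        modularSymbol_div_eq_of_intCast f hℓp.ne_zero b]
      push_cast
      ring_nf
    -- `ℓ ∤ b`
    have hval0 : 0 < (b : ZMod ℓ).val := by
      rw [Nat.pos_iff_ne_zero, ne_eq, ZMod.val_eq_zero]
      intro h0
      have hdvd : (ℓ : ℤ) ∣ b := (ZMod.intCast_zmod_eq_zero_iff_dvd b ℓ).mp h0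
      have hcopℓ : IsCoprime (ℓ : ℤ) b := by
        rw [hk]
        exact hcopb.add_mul_right_left (N * k)
      have hu : IsUnit (ℓ : ℤ) := hcopℓ.isUnit_of_dvd' (dvd_refl _) hdvd
      rcases Int.isUnit_iff.mp hu with h1 | h1
      · exact hℓp.one_lt.ne' (by exact_mod_cast h1)
      · have : (0 : ℤ) ≤ (ℓ : ℤ) := by positivity
        omega
    refine AddSubgroup.subset_closure ⟨ℓ, hℓp, lt_of_le_of_lt (le_max_left _ _) hℓn, ?_,
      (b : ZMod ℓ).val, hval0, ZMod.val_lt _, hper⟩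
    -- `ℓ ≡ d (mod N)`
    exact Int.modEq_iff_dvd.mpr ⟨-(k * b), by rw [hk]; ring⟩

/-- **PRIME-CLASS GENERATION.** For `f ∈ S₂(Γ₀(N))` (`N ≥ 1`) and any `n₀`, the period lattice `Λ_f` is the
subgroup of `ℂ` generated by the prime classes `{0, a/ℓ}_f = {∞, a/ℓ}_f − {∞, 0}_f` over the primes `ℓ > n₀`,
`ℓ ∤ N`, and `0 < a < ℓ` (Manin: `Λ_f = { {∞, γ∞}_f }`; `⊆` is the Dirichlet step
`cuspSymbol_mem_closure_primeClass`, `⊇` is `primeClass_mem_periodLattice`). [cite: Manin1972, Prop. 1.4 / Thm. 1.6] -/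
theorem periodLattice_eq_closure_primeClass (n₀ : ℕ) :
    periodLattice f = AddSubgroup.closure
      {z : ℂ | ∃ ℓ : ℕ, ℓ.Prime ∧ n₀ < ℓ ∧ ¬ ℓ ∣ N ∧ ∃ a : ℕ, 0 < a ∧ a < ℓ ∧ z = modularSymbol f ((a : ℚ) / ℓ) - modularSymbol f 0} := by
  apply le_antisymm
  · rw [periodLattice, AddSubgroup.closure_le]
    rintro _ ⟨γ, rfl⟩
    refine AddSubgroup.closure_mono ?_ (cuspSymbol_mem_closure_primeClass f γ (max n₀ N))
    rintro z ⟨ℓ, hℓp, hℓn, -, a, ha0, ha, rfl⟩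
    refine ⟨ℓ, hℓp, lt_of_le_of_lt (le_max_left _ _) hℓn, ?_, a, ha0, ha, rfl⟩
    exact fun h => absurd (Nat.le_of_dvd (Nat.pos_of_ne_zero (NeZero.ne N)) h)
      (not_le.mpr (lt_of_le_of_lt (le_max_right _ _) hℓn))
  · rw [AddSubgroup.closure_le]
    rintro z ⟨ℓ, hℓp, -, hℓN, a, ha0, ha, rfl⟩
    exact primeClass_mem_periodLattice_of_lt f hℓp hℓN ha0 ha

/-- **Prime-class generation at `4 ∣ N` with `ℓ ≡ 3 (mod 4)`**: for `4 ∣ N` and any `n₀`, `Λ_f` is generated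
by the prime classes `{0, a/ℓ}_f` over primes `ℓ > n₀`, `ℓ ∤ N`, `ℓ ≡ 3 (mod 4)`. (For `γ = (a b; c d) ∈ Γ₀(N)`,
`4 ∣ c` forces `d` odd; replacing `γ` by `−γ` — same period — makes `d ≡ 3 (mod 4)`, and the Dirichlet prime
`ℓ ≡ d (mod N)` inherits `ℓ ≡ 3 (mod 4)`.) [cite: Manin1972, Prop. 1.4 / Thm. 1.6] -/
theorem periodLattice_le_closure_primeClass_three_mod_four (h4 : 4 ∣ N) (n₀ : ℕ) :
    periodLattice f ≤ AddSubgroup.closure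
      {z : ℂ | ∃ ℓ : ℕ, ℓ.Prime ∧ n₀ < ℓ ∧ ¬ ℓ ∣ N ∧ ℓ % 4 = 3 ∧
        ∃ a : ℕ, 0 < a ∧ a < ℓ ∧ z = modularSymbol f ((a : ℚ) / ℓ) - modularSymbol f 0} := by
  have hN0 : 0 < N := Nat.pos_of_ne_zero (NeZero.ne N)
  have h4Z : (4 : ℤ) ∣ (N : ℤ) := by exact_mod_cast h4
  -- the progression attached to a matrix with `d ≡ 3 (mod 4)` lands in the target set
  have key : ∀ γ : Gamma0 N, ((γ : SL(2, ℤ)) 1 1 : ℤ) % 4 = 3 →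
      cuspSymbol f γ ∈ AddSubgroup.closure
        {z : ℂ | ∃ ℓ : ℕ, ℓ.Prime ∧ n₀ < ℓ ∧ ¬ ℓ ∣ N ∧ ℓ % 4 = 3 ∧
          ∃ a : ℕ, 0 < a ∧ a < ℓ ∧ z = modularSymbol f ((a : ℚ) / ℓ) - modularSymbol f 0} := by
    intro γ hγ
    refine AddSubgroup.closure_mono ?_ (cuspSymbol_mem_closure_primeClass f γ (max n₀ N))
    rintro z ⟨ℓ, hℓp, hℓn, hℓd, a, ha0, ha, rfl⟩
    refine ⟨ℓ, hℓp, lt_of_le_of_lt (le_max_left _ _) hℓn, ?_, ?_, a, ha0, ha, rfl⟩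
    · exact fun h => absurd (Nat.le_of_dvd hN0 h) (not_le.mpr (lt_of_le_of_lt (le_max_right _ _) hℓn))
    · have h4' : (ℓ : ℤ) % 4 = ((γ : SL(2, ℤ)) 1 1 : ℤ) % 4 := hℓd.of_dvd h4Z
      omega
  rw [periodLattice, AddSubgroup.closure_le]
  rintro _ ⟨γ, rfl⟩
  -- `d` is odd
  have hdet := Matrix.SpecialLinearGroup.det_coe (γ : SL(2, ℤ))
  rw [Matrix.det_fin_two] at hdet
  obtain ⟨c', hc'⟩ : (4 : ℤ) ∣ (γ : SL(2, ℤ)) 1 0 :=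
    dvd_trans h4Z ((ZMod.intCast_zmod_eq_zero_iff_dvd _ N).mp (Gamma0_mem.mp γ.2))
  have hodd : Odd (((γ : SL(2, ℤ)) 0 0 : ℤ) * (γ : SL(2, ℤ)) 1 1) :=
    ⟨2 * ((γ : SL(2, ℤ)) 0 1 * c'), by rw [hc'] at hdet; linear_combination hdet⟩
  have hd : ((γ : SL(2, ℤ)) 1 1 : ℤ) % 2 = 1 := Int.odd_iff.mp (Int.odd_mul.mp hodd).2
  by_cases h3 : ((γ : SL(2, ℤ)) 1 1 : ℤ) % 4 = 3
  · exact key γ h3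
  · obtain ⟨γ', -, h11', hγ'⟩ := exists_gamma0_neg f γ
    rw [← hγ']
    exact key γ' (by rw [h11']; omega)

/-- **Prime-class generation over the ADMISSIBLE primes of E-es-22** (verbatim the index set of
`MultiShiftClassGenerationTwo`): for `4 ∣ N` and any `ℓ₀`, `Λ_f` is generated by the prime classes `{0, a/ℓ}_f`
over the primes `ℓ ≥ ℓ₀` with `ℓ ∤ N`, `ℓ ≡ 3 (mod 4)` and no `t ∈ {8} ∪ {q ∥ N}` congruent to `±1 mod ℓ`
(the last clause is automatic for `ℓ > N + 9`). [cite: Manin1972, Prop. 1.4 / Thm. 1.6] -/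
theorem periodLattice_le_closure_primeClass_admissibleTwo (h4 : 2 ^ 2 ∣ N) (ℓ₀ : ℕ) :
    periodLattice f ≤ AddSubgroup.closure
      {z : ℂ | ∃ ℓ ∈ {ℓ : ℕ | ℓ₀ ≤ ℓ ∧ (ℓ.Prime ∧ ¬ ℓ ∣ N ∧ ℓ % 4 = 3 ∧
          ∀ t ∈ insert 8 (N.primeFactors.filter fun q => ¬ q ^ 2 ∣ N),
            (t : ZMod ℓ) ≠ 1 ∧ (t : ZMod ℓ) ≠ -1)},
        ∃ a : ℕ, 0 < a ∧ a < ℓ ∧ z = modularSymbol f ((a : ℚ) / ℓ) - modularSymbol f 0} := by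
  have hN0 : 0 < N := Nat.pos_of_ne_zero (NeZero.ne N)
  refine le_trans (periodLattice_le_closure_primeClass_three_mod_four f (by norm_num at h4; exact h4)
    (ℓ₀ + N + 9)) (AddSubgroup.closure_mono ?_)
  rintro z ⟨ℓ, hℓp, hℓn, hℓN, hℓ4, a, ha0, ha, rfl⟩
  refine ⟨ℓ, ⟨by omega, hℓp, hℓN, hℓ4, ?_⟩, a, ha0, ha, rfl⟩
  intro t ht
  haveI : NeZero ℓ := ⟨hℓp.ne_zero⟩
  -- `2 ≤ t ≤ max 8 N`, so `1 < t` and `t + 1 < ℓ`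
  have htb : 2 ≤ t ∧ t + 1 < ℓ := by
    rcases Finset.mem_insert.mp ht with rfl | ht'
    · exact ⟨by norm_num, by omega⟩
    · have hq := (Finset.mem_filter.mp ht').1
      have hqp : t.Prime := Nat.prime_of_mem_primeFactors hq
      have hqN : t ≤ N := Nat.le_of_dvd hN0 (Nat.dvd_of_mem_primeFactors hq)
      exact ⟨hqp.two_le, by omega⟩
  refine ⟨fun h1 => ?_, fun h1 => ?_⟩
  · have h := (ZMod.natCast_eq_natCast_iff' t 1 ℓ).mp (by simpa using h1)
    rw [Nat.mod_eq_of_lt (by omega : t < ℓ), Nat.mod_eq_of_lt hℓp.one_lt] at h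
    omega
  · have h : ((t + 1 : ℕ) : ZMod ℓ) = 0 := by
      push_cast
      rw [h1]
      ring
    have hdvd : ℓ ∣ t + 1 := (ZMod.natCast_eq_zero_iff (t + 1) ℓ).mp h
    exact absurd (Nat.le_of_dvd (by omega) hdvd) (by omega)

end CuspSymbolAsPrimeClass

end Summit.BirchSwinnertonDyer.BirchSwinnertonDyer.Theorems.ManinLocalTwoThree

end
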